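import Summits.CriticalPhenomena.PercolationContinuityZ3.Theorems.PercNearOneGluingNoHeavyLowerTailSahiCombTriWSaturated
import Summits.CriticalPhenomena.PercolationContinuityZ3.Theorems.PercNearOneGluingNoHeavyLowerTailSahiCombTriWPrincipal

/-!
# The cross-point certificate `κ_rel` of an up-set inside a face `↑m`: definition, value, and the upper sandwich bound

Support file of the one-cut programme (crux `NoHeavyLowerTail`, stmt-CriticalPhenomena-4575; TRI lane of cell `prim-masterthm`; seat prim-lf-1 gen 39,
memo `FROM-prim-lf-1-gen39-SATURATED-STRATUM.md` §5).  Part 1 of 2 of the RELATIVELY SATURATED stratum of `TRI_W(a)`; part 2 (`…SahiCombTriWRelSaturated`)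
proves the lower bound and the stratum theorem `triW_nonneg_of_relSaturated`.

Fix `m : Finset γ`, the face `Φ = ↑m = {t | m ⊆ t}` and the FACE COMPLEMENT `ρ t = m ∪ tᶜ` (an order-reversing involution of `Φ`; `faceRefl_faceRefl`).
For an up-set `P ⊆ Φ` the CROSS-POINT weight (`FiveUpSet.kapRel`; point pairs `(t, m ∪ tᶜ)`, P5's "tier 2" generator atoms)

  `κ_rel(t, ρ t) = 1` for `t ∈ P ∩ ρP`,   `κ_rel(t, t) = 1` for `t ∈ P \ ρP`

has `κ_rel(A×B) = Σ_{t∈P} ([ρt∈P][t∈A][ρt∈B] + [ρt∉P][t∈A][t∈B])` (`ptVal_kapRel`) and satisfies the UPPER sandwich bound `κ_rel(A×B) ≤ U_P(A,B) =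
2#(P∩A∩B) − #(refl P∩A∩B)` for EVERY up-set `P ⊆ Φ` and all up-sets `A, B` (`ptVal_kapRel_le_uForm`).  PROOF of the bound: the five-up-set theorem
(`fiveUpSetIneq_holds`) for the test up-set `A ∩ Φ` and the nested pairs (m-cylinder of `P \ ρP` ⊆ m-cylinder of `P`), (`∅` ⊆ m-cylinder of `B`) gives
`#{t∈Φ∩A∩B | ρt∈P, t∉P} + #{t∈P∩A | ρt∈P, ρt∈B} ≤ #(P∩A∩B)`; reindex the first count along `ρ`, use `tᶜ ⊆ ρt`, and cancel `Σ_{t∈P∩ρP}([t∈A∩B] − [ρt∈A∩B]) = 0`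
(the involution `ρ` on `P ∩ ρP`).  HONEST LABEL: complete proofs, std axioms; no saturation hypothesis is used in this part. [this work]
-/


namespace Summit.CriticalPhenomena.PercolationContinuityZ3.Theorems

namespace FiveUpSet

open Finset

variable {β γ : Type} [DecidableEq β] [Fintype β] [DecidableEq γ] [Fintype γ]

/-! ### Face complement algebra -/

omit [DecidableEq β] [Fintype β] in
/-- `ρ (ρ t) = t` on the face: `m ∪ (m ∪ tᶜ)ᶜ = t` for `m ⊆ t`. [this work] -/
theorem faceRefl_faceRefl {m t : Finset γ} (h : m ⊆ t) : m ∪ (m ∪ tᶜ)ᶜ = t := by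
  ext i; simp only [mem_union, mem_compl, not_or, not_not]
  constructor
  · rintro (hi | ⟨-, hi⟩); exacts [h hi, hi]
  · intro hi; by_cases him : i ∈ m; exacts [Or.inl him, Or.inr ⟨him, hi⟩]

omit [DecidableEq β] [Fintype β] in
/-- `(m ∪ tᶜ) \ m = tᶜ` for `m ⊆ t`. [this work] -/
theorem faceRefl_sdiff {m t : Finset γ} (h : m ⊆ t) : (m ∪ tᶜ) \ m = tᶜ := by
  ext i; simp only [mem_sdiff, mem_union, mem_compl]
  constructor
  · rintro ⟨hi | hi, hm⟩; exacts [absurd hi hm, hi]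
  · intro hi; exact ⟨Or.inr hi, fun hm => hi (h hm)⟩

omit [DecidableEq β] [Fintype β] in
/-- `(m ∪ tᶜ)ᶜ = t \ m`. [this work] -/
theorem compl_faceRefl (m t : Finset γ) : (m ∪ tᶜ)ᶜ = t \ m := by
  ext i; simp only [mem_compl, mem_union, not_or, not_not, mem_sdiff]; tauto

omit [DecidableEq β] [Fintype β] in
/-- `tᶜ ∪ m = m ∪ tᶜ`. [this work] -/
theorem compl_union_eq (m t : Finset γ) : tᶜ ∪ m = m ∪ tᶜ := union_comm _ _

/-! ### The certificate -/

/-- **The relative Formula-A weight** for the face complement `ρ t = m ∪ tᶜ`: a cross-point unit `(t, ρ t)` for `t ∈ P ∩ ρP`, a diagonal unit for `t ∈ P \ ρP`. [this work] -/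
def kapRel (m : Finset γ) (P : Finset (Finset γ)) (u e : Finset γ) : ℕ :=
  if u ∈ P then (if m ∪ uᶜ ∈ P then (if e = m ∪ uᶜ then 1 else 0) else (if e = u then 1 else 0)) else 0

omit [DecidableEq β] [Fintype β] in
/-- Collapse of the certificate double sum for `κ_rel`. [this work] -/
theorem sum_sum_kapRel (m : Finset γ) (P : Finset (Finset γ)) (x y : Finset γ → ℤ) :
    ∑ u : Finset γ, ∑ e : Finset γ, (kapRel m P u e : ℤ) * x u * y e
      = ∑ u ∈ P, ((if m ∪ uᶜ ∈ P then (1 : ℤ) else 0) * x u * y (m ∪ uᶜ) + (if m ∪ uᶜ ∈ P then (0 : ℤ) else 1) * x u * y u) := by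
  have hin : ∀ u : Finset γ, ∑ e : Finset γ, (kapRel m P u e : ℤ) * x u * y e
      = if u ∈ P then ((if m ∪ uᶜ ∈ P then (1 : ℤ) else 0) * x u * y (m ∪ uᶜ) + (if m ∪ uᶜ ∈ P then (0 : ℤ) else 1) * x u * y u) else 0 := by
    intro u
    by_cases hu : u ∈ P
    · by_cases hc : m ∪ uᶜ ∈ P
      · simp only [kapRel, hu, hc, if_true, one_mul, zero_mul, add_zero]
        rw [Finset.sum_eq_single (m ∪ uᶜ)]
        · simp
        · intro e _ he; simp [he]
        · intro h; exact absurd (mem_univ _) h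
      · simp only [kapRel, hu, hc, if_true, if_false, zero_mul, one_mul, zero_add]
        rw [Finset.sum_eq_single u]
        · simp
        · intro e _ he; simp [he]
        · intro h; exact absurd (mem_univ _) h
    · simp [kapRel, hu]
  rw [Finset.sum_congr rfl (fun u _ => hin u), ← Finset.sum_filter, Finset.filter_mem_eq_inter, Finset.univ_inter]

omit [DecidableEq β] [Fintype β] in
/-- **The value of `κ_rel` on a pair of families**, as a sum over `P`:
`κ_rel(A×B) = Σ_{t∈P} ([ρt ∈ P][t ∈ A][ρt ∈ B] + [ρt ∉ P][t ∈ A][t ∈ B])`. [this work] -/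
theorem ptVal_kapRel (m : Finset γ) (P A B : Finset (Finset γ)) :
    ptVal (kapRel m P) A B = ∑ t ∈ P, ((if m ∪ tᶜ ∈ P then (1 : ℤ) else 0) * ibit (t ∈ A) * ibit (m ∪ tᶜ ∈ B)
      + (if m ∪ tᶜ ∈ P then (0 : ℤ) else 1) * ibit (t ∈ A) * ibit (t ∈ B)) := by
  unfold ptVal
  rw [sum_sum_kapRel m P (fun u => if u ∈ A then (1 : ℤ) else 0) (fun e => if e ∈ B then (1 : ℤ) else 0)]
  rfl

omit [DecidableEq β] [Fintype β] in
/-- **Upper bound `κ_rel(A×B) ≤ U_P(A,B)`** for EVERY up-set `P ⊆ ↑m` (no saturation needed) and all up-sets `A, B`. [this work] -/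
theorem ptVal_kapRel_le_uForm {m : Finset γ} {P A B : Finset (Finset γ)} (hP : IsUpperSet (P : Set (Finset γ)))
    (hPm : ∀ t ∈ P, m ⊆ t)
    (hA : IsUpperSet (A : Set (Finset γ))) (hB : IsUpperSet (B : Set (Finset γ))) :
    ptVal (kapRel m P) A B ≤ uForm P A B := by
  classical
  -- the five-up-set instance: test `A ∩ Φ`, cylinders `X₀ ⊆ X₁` of `P \ ρP ⊆ P`, `∅ ⊆ Y₁` cylinder of `B`
  set Φ : Finset (Finset γ) := univ.filter (fun t => m ⊆ t) with hΦ
  set X₁ : Finset (Finset γ) := univ.filter (fun f => f ∪ m ∈ P) with hX₁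
  set X₀ : Finset (Finset γ) := univ.filter (fun f => f ∪ m ∈ P ∧ m ∪ (f ∪ m)ᶜ ∉ P) with hX₀
  set Y₁ : Finset (Finset γ) := univ.filter (fun f => f ∪ m ∈ B) with hY₁
  have hT : IsUpperSet ((A ∩ Φ : Finset (Finset γ)) : Set (Finset γ)) := by
    rw [coe_inter]; exact hA.inter (isUpperSet_principal m)
  have hX₁u : IsUpperSet (X₁ : Set (Finset γ)) := by
    intro f g hfg hf; rw [mem_coe, hX₁, mem_filter] at hf ⊢
    exact ⟨mem_univ _, hP (union_subset_union hfg (Subset.refl m)) hf.2⟩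
  have hX₀u : IsUpperSet (X₀ : Set (Finset γ)) := by
    intro f g hfg hf; rw [mem_coe, hX₀, mem_filter] at hf ⊢
    refine ⟨mem_univ _, hP (union_subset_union hfg (Subset.refl m)) hf.2.1, fun hg => hf.2.2 ?_⟩
    exact hP (show m ∪ (g ∪ m)ᶜ ≤ m ∪ (f ∪ m)ᶜ from
      union_subset_union (Subset.refl m) (compl_subset_compl.2 (union_subset_union hfg (Subset.refl m)))) hg
  have hY₁u : IsUpperSet (Y₁ : Set (Finset γ)) := by
    intro f g hfg hf; rw [mem_coe, hY₁, mem_filter] at hf ⊢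
    exact ⟨mem_univ _, hB (union_subset_union hfg (Subset.refl m)) hf.2⟩
  have hE : IsUpperSet ((∅ : Finset (Finset γ)) : Set (Finset γ)) := by rw [coe_empty]; exact isUpperSet_empty
  have hX01 : X₀ ⊆ X₁ := by
    intro f hf; rw [hX₀, mem_filter] at hf; rw [hX₁, mem_filter]; exact ⟨hf.1, hf.2.1⟩
  have h5 := fiveUpSetIneq_holds γ (A ∩ Φ) X₀ X₁ ∅ Y₁ hT hX₀u hX₁u hE hY₁u hX01 (empty_subset _)
  have e0 : refl (∅ : Finset (Finset γ)) = ∅ := Finset.map_empty _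
  rw [e0, inter_empty, card_empty, zero_add, sdiff_empty, inter_empty, card_empty, add_zero] at h5
  -- `h5 : #(A∩Φ ∩ refl X₀ ∩ Y₁) + #(A∩Φ ∩ refl (X₁ \ X₀) ∩ refl Y₁) ≤ #(A∩Φ ∩ X₁ ∩ Y₁)`
  -- identify the three sets
  have hm_of_face : ∀ {t : Finset γ}, t ∈ Φ → m ⊆ t := fun ht => by rw [hΦ, mem_filter] at ht; exact ht.2
  have s1 : A ∩ Φ ∩ X₁ ∩ Y₁ ⊆ P ∩ A ∩ B := by
    intro t ht
    simp only [mem_inter] at ht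
    have hmt := hm_of_face ht.1.1.2
    have h1 : t ∈ P := by
      have h := ht.1.2; rw [hX₁, mem_filter, union_eq_left.2 hmt] at h; exact h.2
    have h2 : t ∈ B := by
      have h := ht.2; rw [hY₁, mem_filter, union_eq_left.2 hmt] at h; exact h.2
    exact mem_inter.2 ⟨mem_inter.2 ⟨h1, ht.1.1.1⟩, h2⟩
  -- D-type points: t ∈ Φ ∩ A ∩ B with ρt ∈ P, t ∉ P
  have s2 : (Φ.filter fun t => m ∪ tᶜ ∈ P ∧ t ∉ P) ∩ A ∩ B ⊆ A ∩ Φ ∩ refl X₀ ∩ Y₁ := by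
    intro t ht
    simp only [mem_inter, mem_filter] at ht
    obtain ⟨⟨⟨htΦ, hρ, htP⟩, htA⟩, htB⟩ := ht
    have hmt := hm_of_face htΦ
    refine mem_inter.2 ⟨mem_inter.2 ⟨mem_inter.2 ⟨htA, htΦ⟩, ?_⟩, ?_⟩
    · rw [mem_refl, hX₀, mem_filter]
      refine ⟨mem_univ _, by rwa [compl_union_eq], ?_⟩
      rw [compl_union_eq, faceRefl_faceRefl hmt]; exact htP
    · rw [hY₁, mem_filter, union_eq_left.2 hmt]; exact ⟨mem_univ _, htB⟩
  -- Q-type points: t ∈ P ∩ A with ρt ∈ P and ρt ∈ B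
  have s3 : (P.filter fun t => m ∪ tᶜ ∈ P ∧ m ∪ tᶜ ∈ B) ∩ A ⊆ A ∩ Φ ∩ refl (X₁ \ X₀) ∩ refl Y₁ := by
    intro t ht
    simp only [mem_inter, mem_filter] at ht
    obtain ⟨⟨htP, hρP, hρB⟩, htA⟩ := ht
    have hmt := hPm t htP
    have htΦ : t ∈ Φ := by rw [hΦ, mem_filter]; exact ⟨mem_univ _, hmt⟩
    refine mem_inter.2 ⟨mem_inter.2 ⟨mem_inter.2 ⟨htA, htΦ⟩, ?_⟩, ?_⟩
    · rw [mem_refl, mem_sdiff, hX₁, mem_filter, hX₀, mem_filter, compl_union_eq, faceRefl_faceRefl hmt]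
      exact ⟨⟨mem_univ _, hρP⟩, fun h => h.2.2 htP⟩
    · rw [mem_refl, hY₁, mem_filter, compl_union_eq]; exact ⟨mem_univ _, hρB⟩
  have c1 := card_le_card s1
  have c2 := card_le_card s2
  have c3 := card_le_card s3
  -- so: #(Dpts ∩ A ∩ B) + #(Qpts ∩ A) ≤ #(P ∩ A ∩ B)
  have key : ((Φ.filter fun t => m ∪ tᶜ ∈ P ∧ t ∉ P) ∩ A ∩ B).card + ((P.filter fun t => m ∪ tᶜ ∈ P ∧ m ∪ tᶜ ∈ B) ∩ A).card
      ≤ (P ∩ A ∩ B).card := by omega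
  -- reindex the D-type count along ρ: it equals #{s ∈ P : ρs ∉ P, ρs ∈ A, ρs ∈ B}
  have reidx : ((Φ.filter fun t => m ∪ tᶜ ∈ P ∧ t ∉ P) ∩ A ∩ B).card
      = (P.filter fun s => m ∪ sᶜ ∉ P ∧ m ∪ sᶜ ∈ A ∧ m ∪ sᶜ ∈ B).card := by
    refine Finset.card_nbij' (fun t => m ∪ tᶜ) (fun s => m ∪ sᶜ) ?_ ?_ ?_ ?_
    · intro t ht
      simp only [Finset.mem_coe, mem_inter, mem_filter] at ht
      obtain ⟨⟨⟨htΦ, hρ, htP⟩, htA⟩, htB⟩ := ht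
      have hmt := hm_of_face htΦ
      simp only [Finset.mem_coe, mem_filter, faceRefl_faceRefl hmt]
      exact ⟨hρ, htP, htA, htB⟩
    · intro s hs
      simp only [Finset.mem_coe, mem_filter] at hs
      obtain ⟨hsP, hρP, hρA, hρB⟩ := hs
      have hms := hPm s hsP
      simp only [Finset.mem_coe, mem_inter, mem_filter, faceRefl_faceRefl hms]
      exact ⟨⟨⟨by rw [hΦ, mem_filter]; exact ⟨mem_univ _, subset_union_left⟩, hsP, hρP⟩, hρA⟩, hρB⟩
    · intro t ht
      simp only [Finset.mem_coe, mem_inter, mem_filter] at ht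
      exact faceRefl_faceRefl (hm_of_face ht.1.1.1)
    · intro s hs
      simp only [Finset.mem_coe, mem_filter] at hs
      exact faceRefl_faceRefl (hPm s hs.1)
  -- the involution on `P ∩ ρP`: Σ_{t∈P, ρt∈P} ([t∈A][t∈B] − [ρt∈A][ρt∈B]) = 0
  have invol : ∑ t ∈ P.filter (fun t => m ∪ tᶜ ∈ P), (ibit (t ∈ A) * ibit (t ∈ B) - ibit (m ∪ tᶜ ∈ A) * ibit (m ∪ tᶜ ∈ B)) = 0 := by
    rw [Finset.sum_sub_distrib, sub_eq_zero]
    refine Finset.sum_nbij' (fun t => m ∪ tᶜ) (fun s => m ∪ sᶜ) ?_ ?_ ?_ ?_ ?_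
    · intro t ht; simp only [mem_filter] at ht ⊢
      exact ⟨ht.2, by rw [faceRefl_faceRefl (hPm t ht.1)]; exact ht.1⟩
    · intro s hs; simp only [mem_filter] at hs ⊢
      exact ⟨hs.2, by rw [faceRefl_faceRefl (hPm s hs.1)]; exact hs.1⟩
    · intro t ht; simp only [mem_filter] at ht; exact faceRefl_faceRefl (hPm t ht.1)
    · intro s hs; simp only [mem_filter] at hs; exact faceRefl_faceRefl (hPm s hs.1)
    · intro t ht; simp only [mem_filter] at ht; simp only [faceRefl_faceRefl (hPm t ht.1)]
  -- now everything as sums over `P`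
  have eU : uForm P A B = ∑ t ∈ P, (2 * (ibit (t ∈ A) * ibit (t ∈ B)) - ibit (tᶜ ∈ A) * ibit (tᶜ ∈ B)) := by
    unfold uForm
    rw [card_refl_inter_inter, card_inter_inter_eq_sum_ibit, card_inter_inter_eq_sum_ibit]
    have : ∀ t, ibit (t ∈ refl A) * ibit (t ∈ refl B) = ibit (tᶜ ∈ A) * ibit (tᶜ ∈ B) := by
      intro t; unfold ibit; simp only [mem_refl]
    simp only [this, Finset.mul_sum, ← Finset.sum_sub_distrib]
  have ePAB : ((P ∩ A ∩ B).card : ℤ) = ∑ t ∈ P, ibit (t ∈ A) * ibit (t ∈ B) := card_inter_inter_eq_sum_ibit P A B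
  have eD : (((P.filter fun s => m ∪ sᶜ ∉ P ∧ m ∪ sᶜ ∈ A ∧ m ∪ sᶜ ∈ B).card : ℕ) : ℤ)
      = ∑ t ∈ P, (if m ∪ tᶜ ∈ P then (0 : ℤ) else 1) * ibit (m ∪ tᶜ ∈ A) * ibit (m ∪ tᶜ ∈ B) := by
    rw [Finset.card_filter]
    push_cast
    refine Finset.sum_congr rfl fun t _ => ?_
    unfold ibit; by_cases h1 : m ∪ tᶜ ∈ P <;> by_cases h2 : m ∪ tᶜ ∈ A <;> by_cases h3 : m ∪ tᶜ ∈ B <;> simp [h1, h2, h3]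
  have eQ : (((P.filter fun t => m ∪ tᶜ ∈ P ∧ m ∪ tᶜ ∈ B) ∩ A).card : ℤ)
      = ∑ t ∈ P, (if m ∪ tᶜ ∈ P then (1 : ℤ) else 0) * ibit (t ∈ A) * ibit (m ∪ tᶜ ∈ B) := by
    rw [← Finset.filter_mem_eq_inter, Finset.filter_filter, Finset.card_filter]
    push_cast
    refine Finset.sum_congr rfl fun t _ => ?_
    unfold ibit; by_cases h1 : m ∪ tᶜ ∈ P <;> by_cases h2 : t ∈ A <;> by_cases h3 : m ∪ tᶜ ∈ B <;> simp [h1, h2, h3]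
  have eInv : ∑ t ∈ P.filter (fun t => m ∪ tᶜ ∈ P), (ibit (t ∈ A) * ibit (t ∈ B) - ibit (m ∪ tᶜ ∈ A) * ibit (m ∪ tᶜ ∈ B))
      = ∑ t ∈ P, (if m ∪ tᶜ ∈ P then (1 : ℤ) else 0) * (ibit (t ∈ A) * ibit (t ∈ B) - ibit (m ∪ tᶜ ∈ A) * ibit (m ∪ tᶜ ∈ B)) := by
    rw [Finset.sum_filter]
    refine Finset.sum_congr rfl fun t _ => ?_
    split_ifs <;> simp
  -- pointwise: [tᶜ ∈ A][tᶜ ∈ B] ≤ [ρt ∈ A][ρt ∈ B]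
  have ptw : ∀ t ∈ P, ibit (tᶜ ∈ A) * ibit (tᶜ ∈ B) ≤ ibit (m ∪ tᶜ ∈ A) * ibit (m ∪ tᶜ ∈ B) := by
    intro t _
    have ha : tᶜ ∈ A → m ∪ tᶜ ∈ A := fun h => hA (show tᶜ ≤ m ∪ tᶜ from subset_union_right) h
    have hb : tᶜ ∈ B → m ∪ tᶜ ∈ B := fun h => hB (show tᶜ ≤ m ∪ tᶜ from subset_union_right) h
    have hA' : ibit (tᶜ ∈ A) ≤ ibit (m ∪ tᶜ ∈ A) := by
      unfold ibit; by_cases h1 : tᶜ ∈ A <;> by_cases h2 : m ∪ tᶜ ∈ A <;> simp [h1, h2]; exact h2 (ha h1)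
    have hB' : ibit (tᶜ ∈ B) ≤ ibit (m ∪ tᶜ ∈ B) := by
      unfold ibit; by_cases h1 : tᶜ ∈ B <;> by_cases h2 : m ∪ tᶜ ∈ B <;> simp [h1, h2]; exact h2 (hb h1)
    have h0A : 0 ≤ ibit (tᶜ ∈ A) := by unfold ibit; split_ifs <;> simp
    have h0B : 0 ≤ ibit (m ∪ tᶜ ∈ B) := by unfold ibit; split_ifs <;> simp
    calc ibit (tᶜ ∈ A) * ibit (tᶜ ∈ B) ≤ ibit (tᶜ ∈ A) * ibit (m ∪ tᶜ ∈ B) := mul_le_mul_of_nonneg_left hB' h0A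
      _ ≤ ibit (m ∪ tᶜ ∈ A) * ibit (m ∪ tᶜ ∈ B) := mul_le_mul_of_nonneg_right hA' h0B
  have hptw := Finset.sum_le_sum ptw
  -- assemble
  have keyZ : (((Φ.filter fun t => m ∪ tᶜ ∈ P ∧ t ∉ P) ∩ A ∩ B).card : ℤ)
      + (((P.filter fun t => m ∪ tᶜ ∈ P ∧ m ∪ tᶜ ∈ B) ∩ A).card : ℤ) ≤ ((P ∩ A ∩ B).card : ℤ) := by exact_mod_cast key
  rw [reidx, eD, eQ, ePAB] at keyZ
  rw [eInv] at invol
  -- pointwise split of the integrand of U − κ_rel into the three pieces controlled by keyZ / invol / hptw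
  have hpt : ∀ t ∈ P, (2 * (ibit (t ∈ A) * ibit (t ∈ B)) - ibit (tᶜ ∈ A) * ibit (tᶜ ∈ B))
      - ((if m ∪ tᶜ ∈ P then (1 : ℤ) else 0) * ibit (t ∈ A) * ibit (m ∪ tᶜ ∈ B)
          + (if m ∪ tᶜ ∈ P then (0 : ℤ) else 1) * ibit (t ∈ A) * ibit (t ∈ B))
      = (ibit (t ∈ A) * ibit (t ∈ B) - (if m ∪ tᶜ ∈ P then (1 : ℤ) else 0) * ibit (t ∈ A) * ibit (m ∪ tᶜ ∈ B)
            - (if m ∪ tᶜ ∈ P then (0 : ℤ) else 1) * ibit (m ∪ tᶜ ∈ A) * ibit (m ∪ tᶜ ∈ B))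
        + (if m ∪ tᶜ ∈ P then (1 : ℤ) else 0) * (ibit (t ∈ A) * ibit (t ∈ B) - ibit (m ∪ tᶜ ∈ A) * ibit (m ∪ tᶜ ∈ B))
        + (ibit (m ∪ tᶜ ∈ A) * ibit (m ∪ tᶜ ∈ B) - ibit (tᶜ ∈ A) * ibit (tᶜ ∈ B)) := by
    intro t _; split_ifs <;> ring
  rw [ptVal_kapRel, eU, ← sub_nonneg, ← Finset.sum_sub_distrib, Finset.sum_congr rfl hpt, Finset.sum_add_distrib,
    Finset.sum_add_distrib]
  have h1 : 0 ≤ ∑ t ∈ P, (ibit (t ∈ A) * ibit (t ∈ B) - (if m ∪ tᶜ ∈ P then (1 : ℤ) else 0) * ibit (t ∈ A) * ibit (m ∪ tᶜ ∈ B)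
            - (if m ∪ tᶜ ∈ P then (0 : ℤ) else 1) * ibit (m ∪ tᶜ ∈ A) * ibit (m ∪ tᶜ ∈ B)) := by
    rw [Finset.sum_sub_distrib, Finset.sum_sub_distrib]; linarith
  have h3 : 0 ≤ ∑ t ∈ P, (ibit (m ∪ tᶜ ∈ A) * ibit (m ∪ tᶜ ∈ B) - ibit (tᶜ ∈ A) * ibit (tᶜ ∈ B)) := by
    rw [Finset.sum_sub_distrib]; linarith
  linarith

end FiveUpSet

end Summit.CriticalPhenomena.PercolationContinuityZ3.Theorems
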